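import Mathlib
import Literature.NumberTheory.Sieve.IwaniecAlmostPrimesProp1Corollary
import HarnessLib

/-!
# The hyperbolic shell (helper toward `stub_poissonReduction`, line `cofactor-root-discrepancy`,
crux `SplitBlockJacobi`, stmt-Parity-11583)

When the bulk region `{(Q, Q′) : QQ′ ≤ X}` is covered by rectangles of relative size `1 + 1/T`,
the pairs not in a rectangle lying entirely below the hyperbola satisfy `X(1 − δ′) < QQ′ ≤ X`
with `δ′ ≍ 1/T`.  On this SHELL no cancellation is available, and we bound the MASS directly:

* `card_filter_Ico_dvd_le` — on `ℓ` consecutive integers `t² + 1 ≡ 0 (mod m)` has at most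
  `(ℓ/m + 1) ρ(m)` solutions (`ρ` = `Iwaniec1978.rho`, exactly `ρ(m)` per period);
* `sum_rho_div_sqrt_le` — `Σ_{m ≤ M} ρ(m)/√m ≤ 5(C+1)√M` from the tree's mean value
  `Σ_{m ≤ y} ρ(m) ≤ C y` (`exists_sum_rho_le`), by dyadic induction;
* `shell_mass_le` — for pairs `Q < Q′` of primes with `X(1−δ′) < QQ′ ≤ X` (`x ≤ X`, `δ′ ≤ 1/2`):
  `Σ_{pairs} #{t ≤ x : QQ′ ∣ t² + 1} ≤ C₁ (δ′ x + x²/X)`: writing `t² + 1 = QQ′·m`, `m ≤ 4x²/X`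
  and for each `m` the admissible `t` lie in an interval of length `≤ δ′ √(mX)`;
* `sum_shell_inv_le` — `Σ_{pairs} 1/(QQ′) ≤ 2δ′(1 + log x) + 2x/X` (harmonic sum).
-/

noncomputable section

open Finset

namespace Summit.Parity.BatemanHorn.Cruxes.SplitBlockJacobi.CofactorRootDiscrepancy.Poisson

open Literature.NumberTheory.Sieve.Iwaniec1978

/-! ### Solutions of `t² + 1 ≡ 0 (mod m)` on an interval -/

/-- On `n` full periods there are exactly `n ρ(m)` solutions. -/
theorem card_filter_Ico_mul_dvd (m a n : ℕ) :
    ((Finset.Ico a (a + n * m)).filter fun t : ℕ => m ∣ t ^ 2 + 1).card = n * rho m := by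
  induction n with
  | zero => simp
  | succ n ih =>
    have hsplit : Finset.Ico a (a + (n + 1) * m) =
        Finset.Ico a (a + n * m) ∪ Finset.Ico (a + n * m) (a + n * m + m) := by
      rw [Finset.Ico_union_Ico_eq_Ico (by omega) (by nlinarith)]
      congr 1; ring
    rw [hsplit, Finset.filter_union,
      Finset.card_union_of_disjoint
        (Finset.disjoint_filter_filter (Finset.Ico_disjoint_Ico_consecutive _ _ _)),
      ih, card_filter_Ico_dvd_sq_add_one]
    ring

/-- On `ℓ` consecutive integers there are at most `(ℓ/m + 1) ρ(m)` solutions (`m ≥ 1`). -/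
theorem card_filter_Ico_dvd_le (m a ℓ : ℕ) (hm : 0 < m) :
    ((Finset.Ico a (a + ℓ)).filter fun t : ℕ => m ∣ t ^ 2 + 1).card ≤ (ℓ / m + 1) * rho m := by
  rw [← card_filter_Ico_mul_dvd m a (ℓ / m + 1)]
  refine Finset.card_le_card (Finset.filter_subset_filter _ (Finset.Ico_subset_Ico le_rfl ?_))
  have : ℓ < (ℓ / m + 1) * m := by
    rw [Nat.add_mul, one_mul]
    have := Nat.lt_div_mul_add hm (a := ℓ)
    linarith [Nat.div_mul_le_self ℓ m, Nat.mod_lt ℓ hm, Nat.div_add_mod ℓ m]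
  omega

/-! ### `Σ ρ(m)/√m` -/

/-- From `Σ_{m ≤ y} ρ(m) ≤ C y` (`y ≥ 2`): `Σ_{m ≤ M} ρ(m)/√m ≤ 5 (C + 1) √M` for all `M ≥ 1`. -/
theorem sum_rho_div_sqrt_le {C : ℝ} (hC0 : 0 < C)
    (hC : ∀ y : ℝ, 2 ≤ y → ∑ m ∈ Finset.Icc 1 ⌊y⌋₊, (rho m : ℝ) ≤ C * y) :
    ∀ M : ℕ, 1 ≤ M → ∑ m ∈ Finset.Icc 1 M, (rho m : ℝ) / Real.sqrt m ≤ 5 * (C + 1) * Real.sqrt M := by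
  intro M
  induction M using Nat.strong_induction_on with
  | _ M ih =>
    intro hM
    rcases Nat.lt_or_ge M 2 with hM2 | hM2
    · have hM1 : M = 1 := by omega
      subst hM1
      simp [show rho 1 = 1 by decide]
      linarith
    · -- split at `M' = M / 2`
      set M' := M / 2 with hM'
      have hM'1 : 1 ≤ M' := by omega
      have hM'M : M' < M := by omega
      have hIH := ih M' hM'M hM'1
      have hsplit : ∑ m ∈ Finset.Icc 1 M, (rho m : ℝ) / Real.sqrt m =
          ∑ m ∈ Finset.Icc 1 M', (rho m : ℝ) / Real.sqrt m +
            ∑ m ∈ Finset.Ioc M' M, (rho m : ℝ) / Real.sqrt m := by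
        rw [show Finset.Icc 1 M = Finset.Ioc 0 M from Finset.Icc_add_one_left_eq_Ioc 0 M,
          show Finset.Icc 1 M' = Finset.Ioc 0 M' from Finset.Icc_add_one_left_eq_Ioc 0 M']
        exact (Finset.sum_Ioc_consecutive _ (Nat.zero_le M') hM'M.le).symm
      have hMR : (2 : ℝ) ≤ M := by exact_mod_cast hM2
      have hM0 : (0 : ℝ) < M := by linarith
      have hhalf : (M : ℝ) / 2 ≤ (M' : ℝ) + 1 := by
        have : M ≤ 2 * M' + 1 := by omega
        have : (M : ℝ) ≤ 2 * M' + 1 := by exact_mod_cast this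
        linarith
      have hM'le : (M' : ℝ) ≤ M / 2 := by
        have : 2 * M' ≤ M := by omega
        have : (2 : ℝ) * M' ≤ M := by exact_mod_cast this
        linarith
      -- the top half: each `1/√m ≤ √(2/M)`
      have htop : ∑ m ∈ Finset.Ioc M' M, (rho m : ℝ) / Real.sqrt m ≤
          Real.sqrt 2 * C * Real.sqrt M := by
        have hterm : ∀ m ∈ Finset.Ioc M' M, (rho m : ℝ) / Real.sqrt m ≤
            (rho m : ℝ) * (Real.sqrt 2 / Real.sqrt M) := by
          intro m hm
          rw [Finset.mem_Ioc] at hm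
          have hm1 : (M' : ℝ) + 1 ≤ m := by exact_mod_cast hm.1
          have hmpos : (0 : ℝ) < m := by linarith [show (0:ℝ) ≤ M' from Nat.cast_nonneg _]
          rw [div_eq_mul_inv]
          refine mul_le_mul_of_nonneg_left ?_ (Nat.cast_nonneg _)
          rw [inv_le_iff_one_le_mul₀ (Real.sqrt_pos.mpr hmpos), div_mul_eq_mul_div,
            one_le_div (Real.sqrt_pos.mpr hM0), ← Real.sqrt_mul (by norm_num : (0:ℝ) ≤ 2)]
          exact Real.sqrt_le_sqrt (by linarith)
        refine (Finset.sum_le_sum hterm).trans ?_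
        rw [← Finset.sum_mul]
        have hsum : ∑ m ∈ Finset.Ioc M' M, (rho m : ℝ) ≤ C * M := by
          have h := hC M hMR
          rw [Nat.floor_natCast] at h
          refine le_trans ?_ h
          rw [show Finset.Icc 1 M = Finset.Ioc 0 M from Finset.Icc_add_one_left_eq_Ioc 0 M]
          refine Finset.sum_le_sum_of_subset_of_nonneg (Finset.Ioc_subset_Ioc (Nat.zero_le _) le_rfl)
            fun _ _ _ => Nat.cast_nonneg _
        calc (∑ m ∈ Finset.Ioc M' M, (rho m : ℝ)) * (Real.sqrt 2 / Real.sqrt M)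
            ≤ C * M * (Real.sqrt 2 / Real.sqrt M) :=
              mul_le_mul_of_nonneg_right hsum (by positivity)
          _ = Real.sqrt 2 * C * Real.sqrt M := by
              have hsM : Real.sqrt M * Real.sqrt M = M := Real.mul_self_sqrt hM0.le
              have hsM0 : 0 < Real.sqrt M := Real.sqrt_pos.mpr hM0
              field_simp
              nlinarith [hsM]
      -- the bottom half by induction: `5(C+1)√M' ≤ 5(C+1)√(M/2)`
      have hbot : ∑ m ∈ Finset.Icc 1 M', (rho m : ℝ) / Real.sqrt m ≤
          5 * (C + 1) * (Real.sqrt M / Real.sqrt 2) := by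
        refine hIH.trans (mul_le_mul_of_nonneg_left ?_ (by positivity))
        rw [le_div_iff₀ (by positivity), ← Real.sqrt_mul (Nat.cast_nonneg _)]
        exact Real.sqrt_le_sqrt (by linarith)
      rw [hsplit]
      have hs2 : Real.sqrt 2 * Real.sqrt 2 = 2 := Real.mul_self_sqrt (by norm_num)
      have hs2pos : 0 < Real.sqrt 2 := Real.sqrt_pos.mpr (by norm_num)
      have hs2lt : Real.sqrt 2 ≤ 3 / 2 := by
        rw [Real.sqrt_le_left (by norm_num)]; norm_num
      have hs2gt : 7 / 5 ≤ Real.sqrt 2 := by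
        rw [Real.le_sqrt (by norm_num) (by norm_num)]; norm_num
      have hsM0 : 0 ≤ Real.sqrt M := Real.sqrt_nonneg _
      -- `5(C+1)/√2 + √2 C ≤ 5(C+1)` since `5/√2 + √2 ≤ 5`
      have key : 5 * (C + 1) * (Real.sqrt M / Real.sqrt 2) + Real.sqrt 2 * C * Real.sqrt M ≤
          5 * (C + 1) * Real.sqrt M := by
        rw [mul_div_assoc', div_add' _ _ _ hs2pos.ne', div_le_iff₀ hs2pos]
        nlinarith [mul_nonneg hC0.le hsM0, hsM0]
      linarith

/-! ### Counting over a product as a sum of fibre cards -/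

/-- `#{(q, t) ∈ P × I : R q t} = Σ_{q ∈ P} #{t ∈ I : R q t}`. -/
theorem card_filter_product_eq_sum {α β : Type*} (P : Finset α) (I : Finset β) (R : α → β → Prop)
    [∀ a b, Decidable (R a b)] :
    ((P ×ˢ I).filter (fun p : α × β => R p.1 p.2)).card =
      ∑ q ∈ P, (I.filter (fun t => R q t)).card := by
  rw [Finset.card_filter, Finset.sum_product]
  refine Finset.sum_congr rfl fun q _ => ?_
  rw [Finset.card_filter]

/-- A pair of primes `Q < Q′` is determined by its product. -/
theorem pair_eq_of_mul_eq {Q Q' R R' : ℕ} (hQ : Q.Prime) (hQ' : Q'.Prime) (hR : R.Prime)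
    (hR' : R'.Prime) (hlt : Q < Q') (hlt' : R < R') (h : Q * Q' = R * R') : Q = R ∧ Q' = R' := by
  have h1 : Q ∣ R * R' := h ▸ dvd_mul_right Q Q'
  have h2 : R ∣ Q * Q' := h.symm ▸ dvd_mul_right R R'
  rcases (Nat.Prime.dvd_mul hQ).mp h1 with hQR | hQR'
  · have hQR : Q = R := (Nat.prime_dvd_prime_iff_eq hQ hR).mp hQR
    subst hQR
    exact ⟨rfl, Nat.eq_of_mul_eq_mul_left hQ.pos h⟩
  · have hQR' : Q = R' := (Nat.prime_dvd_prime_iff_eq hQ hR').mp hQR'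
    rcases (Nat.Prime.dvd_mul hR).mp h2 with hRQ | hRQ'
    · have := (Nat.prime_dvd_prime_iff_eq hR hQ).mp hRQ; omega
    · have := (Nat.prime_dvd_prime_iff_eq hR hQ').mp hRQ'; omega

/-! ### The solutions attached to one cofactor `m` lie in a short interval -/

/-- For `m ≥ 1` the set `U = {1 ≤ t ≤ x : m ∣ t²+1, X(1−δ′)m < t²+1 ≤ Xm}` has
`#U ≤ (√(δ′Xm)/m + 2) ρ(m)` (its diameter is `≤ √(δ′ X m)`). -/
theorem card_cofactor_fibre_le (x m : ℕ) (hm : 0 < m) (X δ' : ℝ) :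
    ((((Finset.Icc 1 x).filter (fun t : ℕ => m ∣ t ^ 2 + 1 ∧
        X * (1 - δ') * m < ((t ^ 2 + 1 : ℕ) : ℝ) ∧ ((t ^ 2 + 1 : ℕ) : ℝ) ≤ X * m)).card : ℕ) : ℝ) ≤
      (Real.sqrt (δ' * X * m) / m + 2) * rho m := by
  set U := (Finset.Icc 1 x).filter (fun t : ℕ => m ∣ t ^ 2 + 1 ∧
        X * (1 - δ') * m < ((t ^ 2 + 1 : ℕ) : ℝ) ∧ ((t ^ 2 + 1 : ℕ) : ℝ) ≤ X * m) with hU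
  rcases U.eq_empty_or_nonempty with hUe | hUne
  · rw [hUe]; simp; positivity
  · set t₁ := U.min' hUne with ht₁
    set t₂ := U.max' hUne with ht₂
    have ht₁U : t₁ ∈ U := Finset.min'_mem U hUne
    have ht₂U : t₂ ∈ U := Finset.max'_mem U hUne
    have h12 : t₁ ≤ t₂ := Finset.min'_le U t₂ ht₂U
    -- diameter bound
    have hdiam : ((t₂ : ℝ) - t₁) ≤ Real.sqrt (δ' * X * m) := by
      rw [hU, Finset.mem_filter] at ht₁U ht₂U
      have hlow := ht₁U.2.2.1
      have hup := ht₂U.2.2.2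
      push_cast at hlow hup
      have h12R : (t₁ : ℝ) ≤ t₂ := by exact_mod_cast h12
      have ht₁0 : (0 : ℝ) ≤ t₁ := Nat.cast_nonneg _
      refine Real.le_sqrt_of_sq_le ?_
      nlinarith
    -- `U` sits inside `ℓ = t₂ - t₁ + 1` consecutive integers
    have hsub : U ⊆ (Finset.Ico t₁ (t₁ + (t₂ - t₁ + 1))).filter fun t : ℕ => m ∣ t ^ 2 + 1 := by
      intro t ht
      have h1 : t₁ ≤ t := Finset.min'_le U t ht
      have h2 : t ≤ t₂ := Finset.le_max' U t ht
      rw [hU, Finset.mem_filter] at ht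
      rw [Finset.mem_filter, Finset.mem_Ico]
      exact ⟨⟨h1, by omega⟩, ht.2.1⟩
    have hcard := (Finset.card_le_card hsub).trans (card_filter_Ico_dvd_le m t₁ _ hm)
    have hcardR : (U.card : ℝ) ≤ (((t₂ - t₁ + 1) / m + 1 : ℕ) : ℝ) * rho m := by
      exact_mod_cast hcard
    refine hcardR.trans (mul_le_mul_of_nonneg_right ?_ (Nat.cast_nonneg _))
    have hmR : (0 : ℝ) < m := by exact_mod_cast hm
    have hm1 : (1 : ℝ) ≤ m := by exact_mod_cast hm
    have hdiv : (((t₂ - t₁ + 1) / m : ℕ) : ℝ) ≤ ((t₂ - t₁ + 1 : ℕ) : ℝ) / m :=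
      Nat.cast_div_le
    push_cast [Nat.cast_sub h12] at hdiv ⊢
    have : ((t₂ : ℝ) - t₁ + 1) / m ≤ Real.sqrt (δ' * X * m) / m + 1 := by
      rw [div_add_one hmR.ne', div_le_div_iff_of_pos_right hmR]
      linarith
    linarith

/-! ### The shell mass bound -/

/-- **Mass of the hyperbolic shell.** There is `C₁ > 0` such that for `1 ≤ x ≤ X`,
`0 < δ′ ≤ 1/2` and any set `P` of prime pairs `Q < Q′` with `X(1−δ′) < QQ′ ≤ X`:
`Σ_{(Q,Q′) ∈ P} #{1 ≤ t ≤ x : QQ′ ∣ t²+1} ≤ C₁ (√δ′ · x + x²/X + 1)`. -/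
theorem shell_mass_le : ∃ C₁ : ℝ, 0 < C₁ ∧ ∀ (x : ℕ) (X δ' : ℝ), 1 ≤ x → (x : ℝ) ≤ X →
    0 < δ' → δ' ≤ 1 / 2 → ∀ P : Finset (ℕ × ℕ),
      (∀ q ∈ P, q.1.Prime ∧ q.2.Prime ∧ q.1 < q.2 ∧
        X * (1 - δ') < ((q.1 * q.2 : ℕ) : ℝ) ∧ ((q.1 * q.2 : ℕ) : ℝ) ≤ X) →
      ∑ q ∈ P, ((((Finset.Icc 1 x).filter (fun t : ℕ => q.1 * q.2 ∣ t ^ 2 + 1)).card : ℕ) : ℝ) ≤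
        C₁ * (Real.sqrt δ' * x + (x : ℝ) ^ 2 / X + 1) := by
  obtain ⟨C, hC0, hC⟩ := exists_sum_rho_le
  refine ⟨10 * (C + 1), by positivity, ?_⟩
  intro x X δ' hx hxX hδ0 hδ2 P hP
  have hx0 : (0 : ℝ) < x := by exact_mod_cast hx
  have hX0 : 0 < X := lt_of_lt_of_le hx0 hxX
  -- the cofactor range
  set M₀ : ℕ := ⌊4 * (x : ℝ) ^ 2 / X⌋₊ with hM₀
  have hM₀le : (M₀ : ℝ) ≤ 4 * (x : ℝ) ^ 2 / X := Nat.floor_le (by positivity)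
  -- Step 1: the count as the card of a set of pairs `(q, t)`
  have hstep1 : ∑ q ∈ P, (((Finset.Icc 1 x).filter (fun t : ℕ => q.1 * q.2 ∣ t ^ 2 + 1)).card : ℝ) =
      (((P ×ˢ Finset.Icc 1 x).filter (fun p : (ℕ × ℕ) × ℕ => p.1.1 * p.1.2 ∣ p.2 ^ 2 + 1)).card : ℝ) := by
    have h := card_filter_product_eq_sum P (Finset.Icc 1 x) (fun q t => q.1 * q.2 ∣ t ^ 2 + 1)
    exact_mod_cast h.symm
  -- Step 2: the target set of pairs `(m, t)`
  set U : ℕ → Finset ℕ := fun m => (Finset.Icc 1 x).filter (fun t : ℕ => m ∣ t ^ 2 + 1 ∧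
      X * (1 - δ') * m < ((t ^ 2 + 1 : ℕ) : ℝ) ∧ ((t ^ 2 + 1 : ℕ) : ℝ) ≤ X * m) with hUdef
  set S' := (Finset.Icc 1 M₀ ×ˢ Finset.Icc 1 x).filter (fun p : ℕ × ℕ => p.1 ∣ p.2 ^ 2 + 1 ∧
      X * (1 - δ') * p.1 < ((p.2 ^ 2 + 1 : ℕ) : ℝ) ∧ ((p.2 ^ 2 + 1 : ℕ) : ℝ) ≤ X * p.1) with hS'
  have hinj : ((P ×ˢ Finset.Icc 1 x).filter
      (fun p : (ℕ × ℕ) × ℕ => p.1.1 * p.1.2 ∣ p.2 ^ 2 + 1)).card ≤ S'.card := by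
    refine Finset.card_le_card_of_injOn (fun p => ((p.2 ^ 2 + 1) / (p.1.1 * p.1.2), p.2)) ?_ ?_
    · intro p hp
      rw [Finset.mem_coe, Finset.mem_filter, Finset.mem_product] at hp
      obtain ⟨⟨hq, ht⟩, hdvd⟩ := hp
      obtain ⟨hp1, hp2, hlt, hlo, hhi⟩ := hP p.1 hq
      have hq0 : 0 < p.1.1 * p.1.2 := Nat.mul_pos hp1.pos hp2.pos
      obtain ⟨m, hm⟩ := hdvd
      have hm0 : 0 < m := by
        rcases Nat.eq_zero_or_pos m with h | h
        · rw [h, mul_zero] at hm; omega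
        · exact h
      have hdiv : (p.2 ^ 2 + 1) / (p.1.1 * p.1.2) = m := by
        rw [hm, Nat.mul_div_cancel_left _ hq0]
      have hmR : ((p.2 ^ 2 + 1 : ℕ) : ℝ) = ((p.1.1 * p.1.2 : ℕ) : ℝ) * m := by
        rw [hm]; push_cast; ring
      rw [Finset.mem_coe, hS', Finset.mem_filter, Finset.mem_product, Finset.mem_Icc]
      simp only [hdiv]
      refine ⟨⟨⟨hm0, ?_⟩, ht⟩, ⟨p.1.1 * p.1.2, by rw [hm, mul_comm]⟩, ?_, ?_⟩
      · -- `m ≤ M₀`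
        refine Nat.le_floor ?_
        have htx : p.2 ≤ x := (Finset.mem_Icc.mp ht).2
        have htx' : ((p.2 ^ 2 + 1 : ℕ) : ℝ) ≤ 2 * (x : ℝ) ^ 2 := by
          have : p.2 ^ 2 + 1 ≤ 2 * x ^ 2 := by nlinarith
          exact_mod_cast this
        have hm0R : (0 : ℝ) < m := by exact_mod_cast hm0
        have hmq : X * (1 - δ') * m ≤ ((p.1.1 * p.1.2 : ℕ) : ℝ) * m :=
          (mul_lt_mul_of_pos_right hlo hm0R).le
        rw [le_div_iff₀ hX0]
        nlinarith [hmR]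
      · rw [hmR]; exact mul_lt_mul_of_pos_right hlo (by exact_mod_cast hm0)
      · rw [hmR]; exact mul_le_mul_of_nonneg_right hhi (Nat.cast_nonneg _)
    · intro p hp p' hp' heq
      simp only [Prod.mk.injEq] at heq
      obtain ⟨hm, ht⟩ := heq
      rw [Finset.mem_coe, Finset.mem_filter, Finset.mem_product] at hp hp'
      obtain ⟨hp1, hp2, hlt, -, -⟩ := hP p.1 hp.1.1
      obtain ⟨hp1', hp2', hlt', -, -⟩ := hP p'.1 hp'.1.1
      rw [ht] at hm
      have hdvd : p.1.1 * p.1.2 ∣ p'.2 ^ 2 + 1 := ht ▸ hp.2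
      have hprod : p.1.1 * p.1.2 = p'.1.1 * p'.1.2 :=
        (Nat.div_eq_iff_eq_of_dvd_dvd (Nat.succ_ne_zero _) hdvd hp'.2).mp hm
      obtain ⟨e1, e2⟩ := pair_eq_of_mul_eq hp1 hp2 hp1' hp2' hlt hlt' hprod
      exact Prod.ext (Prod.ext e1 e2) ht
  -- Step 3: the card of `S'` fibrewise
  have hstep3 : (S'.card : ℝ) = ∑ m ∈ Finset.Icc 1 M₀, ((U m).card : ℝ) := by
    rw [hS', card_filter_product_eq_sum (Finset.Icc 1 M₀) (Finset.Icc 1 x)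
      (fun m t => m ∣ t ^ 2 + 1 ∧ X * (1 - δ') * m < ((t ^ 2 + 1 : ℕ) : ℝ) ∧
        ((t ^ 2 + 1 : ℕ) : ℝ) ≤ X * m), Nat.cast_sum]
  -- Step 4: sum the fibre bounds
  have hfib : ∑ m ∈ Finset.Icc 1 M₀, ((U m).card : ℝ) ≤
      ∑ m ∈ Finset.Icc 1 M₀, (Real.sqrt (δ' * X * m) / m + 2) * rho m :=
    Finset.sum_le_sum fun m hm => card_cofactor_fibre_le x m (Finset.mem_Icc.mp hm).1 X δ'
  have hsplit : ∑ m ∈ Finset.Icc 1 M₀, (Real.sqrt (δ' * X * m) / m + 2) * (rho m : ℝ) =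
      Real.sqrt (δ' * X) * ∑ m ∈ Finset.Icc 1 M₀, (rho m : ℝ) / Real.sqrt m +
        2 * ∑ m ∈ Finset.Icc 1 M₀, (rho m : ℝ) := by
    rw [Finset.mul_sum, Finset.mul_sum, ← Finset.sum_add_distrib]
    refine Finset.sum_congr rfl fun m hm => ?_
    have hm0 : (0 : ℝ) < m := by exact_mod_cast (Finset.mem_Icc.mp hm).1
    have hsq : Real.sqrt (δ' * X * m) = Real.sqrt (δ' * X) * Real.sqrt m :=
      Real.sqrt_mul (by positivity) _
    calc (Real.sqrt (δ' * X * m) / m + 2) * (rho m : ℝ)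
        = (Real.sqrt (δ' * X) * (Real.sqrt m / m) + 2) * (rho m : ℝ) := by rw [hsq, mul_div_assoc]
      _ = (Real.sqrt (δ' * X) * (1 / Real.sqrt m) + 2) * (rho m : ℝ) := by rw [Real.sqrt_div_self']
      _ = _ := by ring
  -- the two `ρ`-sums
  have hsum1 : ∑ m ∈ Finset.Icc 1 M₀, (rho m : ℝ) ≤ C * (M₀ + 2) := by
    have h := hC (max (M₀ : ℝ) 2) (le_max_right _ _)
    have hfl : M₀ ≤ ⌊max (M₀ : ℝ) 2⌋₊ := Nat.le_floor (le_max_left _ _)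
    calc ∑ m ∈ Finset.Icc 1 M₀, (rho m : ℝ) ≤ ∑ m ∈ Finset.Icc 1 ⌊max (M₀ : ℝ) 2⌋₊, (rho m : ℝ) :=
          Finset.sum_le_sum_of_subset_of_nonneg (Finset.Icc_subset_Icc le_rfl hfl)
            fun _ _ _ => Nat.cast_nonneg _
      _ ≤ C * max (M₀ : ℝ) 2 := h
      _ ≤ C * (M₀ + 2) := by
          refine mul_le_mul_of_nonneg_left (max_le (by linarith) ?_) hC0.le
          linarith [(Nat.cast_nonneg M₀ : (0 : ℝ) ≤ M₀)]
  have hsum2 : Real.sqrt (δ' * X) * ∑ m ∈ Finset.Icc 1 M₀, (rho m : ℝ) / Real.sqrt m ≤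
      Real.sqrt (δ' * X) * (5 * (C + 1) * Real.sqrt M₀) := by
    rcases Nat.eq_zero_or_pos M₀ with h0 | h0
    · rw [h0]; simp
    · exact mul_le_mul_of_nonneg_left (sum_rho_div_sqrt_le hC0 hC M₀ h0) (Real.sqrt_nonneg _)
  -- `√(δ′X) √M₀ ≤ 2 √δ′ x`
  have hgeom : Real.sqrt (δ' * X) * Real.sqrt M₀ ≤ 2 * Real.sqrt δ' * x := by
    rw [← Real.sqrt_mul (by positivity)]
    have h4 : δ' * X * M₀ ≤ (2 * Real.sqrt δ' * x) ^ 2 := by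
      rw [mul_pow, mul_pow, Real.sq_sqrt hδ0.le]
      have : δ' * X * M₀ ≤ δ' * X * (4 * (x : ℝ) ^ 2 / X) :=
        mul_le_mul_of_nonneg_left hM₀le (by positivity)
      rw [mul_div_assoc', mul_comm (δ' * X), mul_assoc, mul_div_assoc,
        mul_div_cancel_left₀ _ hX0.ne'] at this
      nlinarith
    calc Real.sqrt (δ' * X * M₀) ≤ Real.sqrt ((2 * Real.sqrt δ' * x) ^ 2) := Real.sqrt_le_sqrt h4
      _ = 2 * Real.sqrt δ' * x := Real.sqrt_sq (by positivity)
  -- assemble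
  rw [hstep1]
  refine ((Nat.cast_le.mpr hinj).trans_eq hstep3).trans (hfib.trans ?_)
  rw [hsplit]
  have hC1 : 0 ≤ C + 1 := by linarith
  calc Real.sqrt (δ' * X) * ∑ m ∈ Finset.Icc 1 M₀, (rho m : ℝ) / Real.sqrt m +
        2 * ∑ m ∈ Finset.Icc 1 M₀, (rho m : ℝ)
      ≤ Real.sqrt (δ' * X) * (5 * (C + 1) * Real.sqrt M₀) + 2 * (C * (M₀ + 2)) :=
        add_le_add hsum2 (by linarith)
    _ = 5 * (C + 1) * (Real.sqrt (δ' * X) * Real.sqrt M₀) + 2 * C * M₀ + 4 * C := by ring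
    _ ≤ 5 * (C + 1) * (2 * Real.sqrt δ' * x) + 2 * C * (4 * (x : ℝ) ^ 2 / X) + 4 * C := by
        refine add_le_add (add_le_add (mul_le_mul_of_nonneg_left hgeom (by positivity))
          (mul_le_mul_of_nonneg_left hM₀le (by positivity))) le_rfl
    _ ≤ 10 * (C + 1) * (Real.sqrt δ' * x + (x : ℝ) ^ 2 / X + 1) := by
        have h1 : 0 ≤ (x : ℝ) ^ 2 / X := by positivity
        have h3 : 2 * C * (4 * (x : ℝ) ^ 2 / X) ≤ 10 * (C + 1) * ((x : ℝ) ^ 2 / X) := by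
          rw [show 2 * C * (4 * (x : ℝ) ^ 2 / X) = (8 * C) * ((x : ℝ) ^ 2 / X) by ring]
          exact mul_le_mul_of_nonneg_right (by linarith) h1
        nlinarith [h3]

end Summit.Parity.BatemanHorn.Cruxes.SplitBlockJacobi.CofactorRootDiscrepancy.Poisson

namespace Summit.Parity.BatemanHorn.Cruxes.SplitBlockJacobi.CofactorRootDiscrepancy

/-- **Registered stub form** of `Poisson.shell_mass_le`: the identical statement, declared in the crux
namespace under the name registered on stmt-Parity-11583 (`ledger workitem stub-add`). -/
theorem shell_mass_le :
    ∃ C₁ : ℝ, 0 < C₁ ∧ ∀ (x : ℕ) (X δ' : ℝ), 1 ≤ x → (x : ℝ) ≤ X → 0 < δ' → δ' ≤ 1 / 2 → ∀ P : Finset (ℕ × ℕ), (∀ q ∈ P, q.1.Prime ∧ q.2.Prime ∧ q.1 < q.2 ∧ X * (1 - δ') < ((q.1 * q.2 : ℕ) : ℝ) ∧ ((q.1 * q.2 : ℕ) : ℝ) ≤ X) → ∑ q ∈ P, ((((Finset.Icc 1 x).filter (fun t : ℕ => q.1 * q.2 ∣ t ^ 2 + 1)).card : ℕ) : ℝ)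 ≤ C₁ * (Real.sqrt δ' * x + (x : ℝ) ^ 2 / X + 1) :=
  @Poisson.shell_mass_le

end Summit.Parity.BatemanHorn.Cruxes.SplitBlockJacobi.CofactorRootDiscrepancy

end
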